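import Summits.CriticalPhenomena.PercolationContinuityZ3.Theorems.Transplant.SkelFrmBParamsFineSize
import Summits.CriticalPhenomena.PercolationContinuityZ3.Theorems.Transplant.SkelNegBParamsFineSize
import Summits.CriticalPhenomena.PercolationContinuityZ3.Theorems.Transplant.SkelNegBChoiceAll
import Summits.CriticalPhenomena.PercolationContinuityZ3.Theorems.Transplant.TwoAxisParaCellsFineFrame
import Summits.CriticalPhenomena.PercolationContinuityZ3.Theorems.Transplant.SkelFrmFrom1SlotTypes
import Summits.CriticalPhenomena.PercolationContinuityZ3.Theorems.Transplant.SkelFrm1SlotTypes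
import Summits.CriticalPhenomena.PercolationContinuityZ3.Theorems.Transplant.SkelFrmFrom1ParamsPO
import Summits.CriticalPhenomena.PercolationContinuityZ3.Theorems.Transplant.SkelFrm1ParamsPO
import Summits.CriticalPhenomena.PercolationContinuityZ3.Theorems.Transplant.SkelFrmFrom1ParamsLBL
import Summits.CriticalPhenomena.PercolationContinuityZ3.Theorems.Transplant.SkelFrm1ParamsLBL
import Summits.CriticalPhenomena.PercolationContinuityZ3.Theorems.Transplant.SkelFrmFrom1ParamsLF
import Summits.CriticalPhenomena.PercolationContinuityZ3.Theorems.Transplant.SkelFrm1ParamsLF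
import Summits.CriticalPhenomena.PercolationContinuityZ3.Theorems.Transplant.SkelFrmFrom1ParamsLO
import Summits.CriticalPhenomena.PercolationContinuityZ3.Theorems.Transplant.SkelFrm1ParamsLO
import Summits.CriticalPhenomena.PercolationContinuityZ3.Theorems.Transplant.SkelFrmFromBParamsLF
import Summits.CriticalPhenomena.PercolationContinuityZ3.Theorems.Transplant.SkelFrmBParamsLF
import Summits.CriticalPhenomena.PercolationContinuityZ3.Theorems.Transplant.SkelFrmBParamsLO
import Summits.CriticalPhenomena.PercolationContinuityZ3.Theorems.Transplant.SkelNegBParamsSched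
import Summits.CriticalPhenomena.PercolationContinuityZ3.Theorems.Transplant.PlanarSkeletonFrmFromDefs
import Summits.CriticalPhenomena.PercolationContinuityZ3.Theorems.Transplant.PlanarSkeletonFrmDefs
import Summits.CriticalPhenomena.PercolationContinuityZ3.Theorems.Transplant.SkelPhiStepIDataNS
import HarnessLib
import Summits.CriticalPhenomena.PercolationContinuityZ3.Theorems.Transplant.SkelFrmBParamsSched
-- stmt-g19 WAVE-1 source surgery: rep₂_cen_at / Nrep_cen_le / offN_le / hoffN_at REMOVED from this copy (Geom re-base: `cen ↦ cenS`, `offN` home) — they port with the Geom wave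

/-!
# U-WAVE PORT (RULING D-U, lead g21 2026-08-26; WAVE-U-MANIFEST v3.0 row «SkelFrmBParamsSched» ↦ «SkelFrmFromBParamsSched») of the tree module
# `Transplant/SkelFrmBParamsSched` onto the carrier `PlanarSkeletonFrmFrom` (frames only, cylinders connected from width `ℓ₀` on)

ORIGINAL TITLE: N2 (frames-only node `SamePDropOfSkeletonFrm₁`, OPEN) params column over `PlanarSkeletonFrm` — (ζ″) ledger, shape (B′) of record ((R-14)):

builds on p205010 (kernel theorem, internal audit signed; external expert review pending) — nothing in this file uses p205010; NOTHING is claimed about the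
OPEN node U `SamePDropOfSkeletonFrmFrom₁` (nor U_s / the end state).  Lane `prim-bschramm`, seat `prim-bschramm-p3` gen 26; helper file
(`--supports stmt-CriticalPhenomena-4575 --as helper`).  PORT RULES r1–r4 of RULING D-U: declaration order and proof texts are those of the original,
byte-identical except (i) the carrier token `PlanarSkeletonFrm ↦ PlanarSkeletonFrmFrom` (binders, `namespace`/`end` lines, qualified names of twinned
declarations), (ii) carrier-FREE declarations of the original (φ-level `Skelφ…` blocks and namespace-only arithmetic residents) are NOT re-declared —
this file imports the original and `export`s the twin-free residents (POLICY T / treatment (m1)); residents whose statement mentions a twinned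
constant are copied, (iii) every carrier-binding declaration keeps its explicit binder `(Φ : PlanarSkeletonFrmFrom G)` in its own signature (r2).  Docstrings and citations are the original's.
-/

noncomputable section

open scoped Classical

namespace Summit.CriticalPhenomena.PercolationContinuityZ3.Theorems.Transplant

open Literature.Probability.LatticeModels

/-! ## §1 The representative at an exact multiple -/

namespace TwoAxis.Para

end TwoAxis.Para

namespace PlanarSkeletonFrmFrom

namespace NegB

open SkelConc (Consts)
open Neg

section Sched

/-! ## §2 The lattice record of the cells of record and the linear column bound -/

/-- **THE LATTICE RECORD OF RECORD** `prF := ⟨800, n_L, h_L, v_L, v_β, 20K·s₀, 20K·s₁, D⟩` (hp-8's `FinePrm`; `prF.ψ φ′ t = NegB.fine … φ′`). [this work] -/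
def prF (κ : Consts) {V : Type} [DecidableEq V] [Countable V] {G : SimpleGraph V} [G.LocallyFinite] (Φ : PlanarSkeletonFrmFrom G) (t : V) (p : unitInterval) (D : Skelφ.StepI.DataNS V) (g : ℕ) (f : ℕ) : Skelφ.FinePrm where
  A := 800
  n := nL κ Φ t p D g f
  h := hL κ Φ t p D g f
  vα := vL κ Φ t p D g f
  vβ := vβL κ Φ t p D g f
  c₀ := 20 * ((fcells κ Φ t p D g f).K : ℤ) * (((fcells κ Φ t p D g f).s 0 : ℕ) : ℤ)
  c₁ := 20 * ((fcells κ Φ t p D g f).K : ℤ) * (((fcells κ Φ t p D g f).s 1 : ℕ) : ℤ)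
  D := Skelφ.NegPrm.Dof (nL κ Φ t p D g f) (hL κ Φ t p D g f) (ℓL κ Φ t p D g f) (vL κ Φ t p D g f)

/-- The fields of `prF` by `rfl`. [folklore] -/
theorem prF_fields (κ : Consts) {V : Type} [DecidableEq V] [Countable V] {G : SimpleGraph V} [G.LocallyFinite] (Φ : PlanarSkeletonFrmFrom G) (t : V) (p : unitInterval) (D : Skelφ.StepI.DataNS V) (g : ℕ) (f : ℕ) :
    (prF κ Φ t p D g f).A = 800 ∧ (prF κ Φ t p D g f).n = nL κ Φ t p D g f ∧ (prF κ Φ t p D g f).h = hL κ Φ t p D g f ∧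
      (prF κ Φ t p D g f).vα = vL κ Φ t p D g f ∧ (prF κ Φ t p D g f).vβ = vβL κ Φ t p D g f ∧
      (prF κ Φ t p D g f).c₀ = 20 * ((fcells κ Φ t p D g f).K : ℤ) * (((fcells κ Φ t p D g f).s 0 : ℕ) : ℤ) ∧
      (prF κ Φ t p D g f).c₁ = 20 * ((fcells κ Φ t p D g f).K : ℤ) * (((fcells κ Φ t p D g f).s 1 : ℕ) : ℤ) ∧
      (prF κ Φ t p D g f).D = Skelφ.NegPrm.Dof (nL κ Φ t p D g f) (hL κ Φ t p D g f) (ℓL κ Φ t p D g f) (vL κ Φ t p D g f) :=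
  ⟨rfl, rfl, rfl, rfl, rfl, rfl, rfl, rfl⟩

/-- **`prF.ψ φ′ t = NegB.fine … φ′`** (the (F) files' cell map IS the fine window map of record). [folklore] -/
theorem prF_ψ (κ : Consts) {V : Type} [DecidableEq V] [Countable V] {G : SimpleGraph V} [G.LocallyFinite] (Φ : PlanarSkeletonFrmFrom G) (t : V) (p : unitInterval) (D : Skelφ.StepI.DataNS V) (g : ℕ) (f : ℕ) (φ' : V → Site 2) : (prF κ Φ t p D g f).ψ φ' t = fine κ Φ t p D g f φ' := rfl

/-- `prF.D = detD prF.A prF.n prF.h prF.vα prF.vβ` (the determinant slot is the true determinant). [folklore] -/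
theorem prF_D (κ : Consts) {V : Type} [DecidableEq V] [Countable V] {G : SimpleGraph V} [G.LocallyFinite] (Φ : PlanarSkeletonFrmFrom G) (t : V) (p : unitInterval) (D : Skelφ.StepI.DataNS V) (g : ℕ) (f : ℕ) : (prF κ Φ t p D g f).D = TwoAxis.Para.detD (prF κ Φ t p D g f).A (prF κ Φ t p D g f).n (prF κ Φ t p D g f).h (prF κ Φ t p D g f).vα (prF κ Φ t p D g f).vβ :=
  rfl

/-- `0 < prF.c₀`, `0 < prF.c₁`. [folklore] -/
theorem prF_c_pos (κ : Consts) {V : Type} [DecidableEq V] [Countable V] {G : SimpleGraph V} [G.LocallyFinite] (Φ : PlanarSkeletonFrmFrom G) (t : V) (p : unitInterval) (D : Skelφ.StepI.DataNS V) (g : ℕ) (f : ℕ) : 0 < (prF κ Φ t p D g f).c₀ ∧ 0 < (prF κ Φ t p D g f).c₁ := ⟨c_pos κ Φ t p D g f 0, c_pos κ Φ t p D g f 1⟩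

/-- **THE COLUMN CONSTANT OF RECORD** `cOff := 800·(ℓ_L + 21·n_L + 1)` (`≥ 800·max(L̂₀, L̂₁)`). [this work] -/
def cOff (κ : Consts) {V : Type} [DecidableEq V] [Countable V] {G : SimpleGraph V} [G.LocallyFinite] (Φ : PlanarSkeletonFrmFrom G) (t : V) (p : unitInterval) (D : Skelφ.StepI.DataNS V) (g : ℕ) (f : ℕ) : ℕ := 800 * (ℓL κ Φ t p D g f + 21 * nL κ Φ t p D g f + 1)

/-- **The (F) binders `hL0/hL1` at the record** (`c₀·L 0 + 2 ≤ D`, `c₁·L 1 + 2 ≤ D` in `FinePrm`'s vocabulary) from `room_fcells_at`. [folklore] -/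
theorem prF_room (κ : Consts) {V : Type} [DecidableEq V] [Countable V] {G : SimpleGraph V} [G.LocallyFinite] (Φ : PlanarSkeletonFrmFrom G) (t : V) (p : unitInterval) (D : Skelφ.StepI.DataNS V) (g : ℕ) (f : ℕ) (hN : EqNumL κ Φ t p D g f) :
    (prF κ Φ t p D g f).c₀ * (prF κ Φ t p D g f).L 0 + 2 ≤ (prF κ Φ t p D g f).D ∧ (prF κ Φ t p D g f).c₁ * (prF κ Φ t p D g f).L 1 + 2 ≤ (prF κ Φ t p D g f).D := by
  obtain ⟨h0, h1⟩ := room_fcells_at κ Φ t p D g f hN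
  have e0 : (prF κ Φ t p D g f).L 0 = |(800 : ℤ)| * (|vβL κ Φ t p D g f| + |vL κ Φ t p D g f|) := by
    unfold Skelφ.FinePrm.L Skelφ.FinePrm.lvGen
    simp only [if_true, Matrix.cons_val_zero, Matrix.cons_val_one]
    rw [add_comm]; rfl
  have e1 : (prF κ Φ t p D g f).L 1 = |(800 : ℤ)| * (|(nL κ Φ t p D g f : ℤ)| + |hL κ Φ t p D g f|) := by
    unfold Skelφ.FinePrm.L Skelφ.FinePrm.lvGen
    simp only [show ((1 : Fin 2) = 0) = False from propext ⟨fun h => absurd h (by decide), False.elim⟩, if_false, Matrix.cons_val_zero, Matrix.cons_val_one]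
    rfl
  rw [e0, e1]
  exact ⟨h0, h1⟩

end Sched

end NegB

end PlanarSkeletonFrmFrom

end Summit.CriticalPhenomena.PercolationContinuityZ3.Theorems.Transplant

end
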